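import Summits.KontsevichZagierPeriods.KontsevichZagierPeriods.Theorems.UnfoldedStokesStokesGenerationFibrewiseClosure
import Summits.KontsevichZagierPeriods.KontsevichZagierPeriods.Theorems.UnfoldedStokesStokesGenerationFibrewiseClosurePad
import Mathlib.Logic.Equiv.Fintype
import Mathlib.Data.Fin.Pigeonhole

/-!
# `StokesGeneration` (stmt-KontsevichZagierPeriods-3586), line `fibrewise_stokes`, stub `stub_placeCoords` (rung 9)

Closure properties of the S2 class, III: PULL-BACK ALONG A COORDINATE INJECTION. The class
`FibStokesDecomposable M h` of the route's definitions file (`Theorems/UnfoldedStokesDefs.lean`) is stable under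
padding of the source (`fibStokesDecomposable_pad`) and under coordinate permutations
(`fibStokesDecomposable_perm`). Rung 9 of the line assembles separated-variables integrands `Σⱼ fⱼ(x_{aⱼ})` on
`[0,1]^N` from two-variable transposition pieces proved on `[0,1]²`; placing such a piece at the coordinates
`(a, b)` of `[0,1]^N` is the pull-back `x ↦ h (x ∘ e)` along an arbitrary INJECTION `e : Fin M → Fin N` — the
registered stub `stub_placeCoords`, proved here.

Proof (pure bookkeeping): an injection `Fin M → Fin N` forces `M ≤ N` (`Fin.le_of_injective`); the two injections
`Fin.castLE` and `e` of `Fin M` into the finite type `Fin N` differ by a permutation `σ` of `Fin N`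
(`Equiv.Perm.exists_extending_pair`), `σ (Fin.castLE _ i) = e i`; hence
`h (x ∘ e) = (h ∘ pr) (x ∘ σ)` with `pr` the projection to the first `M` coordinates, and the claim is
`fibStokesDecomposable_perm` applied to `fibStokesDecomposable_pad`.

References: J. Ayoub, *Une version relative de la conjecture des périodes de Kontsevich–Zagier*, Ann. of Math. 181
(2015), Rem. 1.5; M. Kontsevich, D. Zagier, *Periods* (2001), §1.2 rule (3).
-/

noncomputable section

set_option linter.dupNamespace false

namespace Summit.KontsevichZagierPeriods.KontsevichZagierPeriods.Cruxes.StokesGeneration.FibrewiseStokes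

/-- **Pull-back along a coordinate injection (registered stub `stub_placeCoords`).** If `h` is fibrewise-Stokes
decomposable on `[0,1]^M` and `e : Fin M → Fin N` is injective, then `x ↦ h (x ∘ e)` is fibrewise-Stokes
decomposable on `[0,1]^N`: extend `e` to a permutation `σ` of `Fin N` with `σ ∘ Fin.castLE = e`
(`Equiv.Perm.exists_extending_pair`), pad the source (`fibStokesDecomposable_pad`) and relabel the coordinates
along `σ` (`fibStokesDecomposable_perm`). [folklore] -/
theorem stub_placeCoords :
    ∀ (M : ℕ) (h : (Fin M → ℝ) → ℝ), FibStokesDecomposable M h →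
      ∀ (N : ℕ) (e : Fin M → Fin N), Function.Injective e →
        FibStokesDecomposable N (fun x => h (fun i => x (e i))) := by
  intro M h hh N e he
  have hMN : M ≤ N := Fin.le_of_injective e he
  obtain ⟨σ, hσ⟩ :=
    Equiv.Perm.exists_extending_pair (Fin.castLE hMN) e (Fin.castLE_injective hMN) he
  have key := fibStokesDecomposable_perm N σ _ (fibStokesDecomposable_pad M N hMN h hh)
  simpa only [hσ] using key

end Summit.KontsevichZagierPeriods.KontsevichZagierPeriods.Cruxes.StokesGeneration.FibrewiseStokes

end
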